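/-
Copyright (c) 2026 the pub-hodgecm-mathlib formalisation cell (harness21).  Prover seat hodgecm-mathlib-K2E3-p12 (g5), Track B «K2-LIT» ∕ h413
(`stmt-HodgeConjecture-24833`), line `K2_E3_EllipticInputs`, unit U12-d, §L (G⁺-split): THE `hB` DOCK — the class orbital integrals `ν_{𝒪ₐ}` of an index-two
`det`-class subgroup from the FULL regular nilpotent orbital integral and ONE `θ`-TWISTED orbital integral.  2026-09-04.
-/
import Summits.HodgeConjecture.HodgeConjecture.Theorems.K2E3GL2NmNilpotentFourierRegularOfOrbits     -- ★ p857331 (K2E3-p12 g4): `fourierRegular_of_eq_delta_add_sum`, `hB` frame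
import Summits.HodgeConjecture.HodgeConjecture.Theorems.K2E3GL2NilpotentOrbitsDetClassChart         -- ★ p857391 (K2E3-p12 g4): `setOf_chart_mem_orbit_eq` (class sets in the chart)
import Summits.HodgeConjecture.HodgeConjecture.Theorems.K2E3U2NilpotentFourierRegularOfGL2NmOrbits  -- ★ p857380 (K2E3-p12 g4): (LBU-2⁺) ⟸ `hB` at the CM place
import Summits.HodgeConjecture.HodgeConjecture.Theorems.K2E3GL2RegularNilpotentFourier              -- ★ p857214 (K2E5-p10 g4): (LBGL-2b) `gl2RegularNilpotentFourier` (F_reg)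
import Literature.NumberTheory.Automorphic.LocalFieldHaarBalls                                      -- ★ `measure_singleton_zero`
import HarnessLib

/-!
# K2_E3 road (h413), §L — (G⁺-split): the `hB` dock «`ν̂_{𝒪ₐ} = ½ μ̂_reg + ½ θ(a) ν̂_θ`»

Cell `pub/hodgecm-mathlib` (D-0151), Track B, seat K2E3-p12 (g5), §L line lead (road «U-iso-T»).  `--supports stmt-HodgeConjecture-24833 --as helper`; THEOREMS ONLY
(no definition ∕ instance ∕ notation ∕ named fact ∕ `sorry`); never imports `Cruxes/…/Lines`.  Count-neutral plumbing: with this file the residual (LBU-2⁺)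
«(L-B_GL)^{Nm} on `𝔤𝔩₂(L⁺_v)`» of ★ p857300 ∕ ★ p857380 hangs on ONE analytic statement, the regularity of the `θ`-twisted regular nilpotent orbital integral
(`hTw`; K2E5-p17 (g3) line side ★, K2E5-p10 (g4) K-side).

Setting: `F` a non-archimedean local field, `D ≤ Fˣ` a subgroup of index two containing the squares (at the CM place: `D = Nm(L_wˣ)`), `θ : F → ℂ` any function with
`θ(u) = 1` for units `u ∈ D` and `θ(u) = −1` for units `u ∉ D` (the value `θ 0` is immaterial: `{t = 0}` is `κ ⊗ dx`-null).  The class set of ★ p857116 ∕ p857331 in the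
chart `(k, t) ↦ k·tE₁₂·k⁻¹` is `Sₐ = {t ≠ 0, a⁻¹·t·det k ∈ D}` (★ p857391).

* §1 `inv_mul_mem_iff_of_index_two`, `theta_mul_self`, `indicator_coeff_eq` — index-two bookkeeping: `1[a⁻¹u ∈ D] = ½(1 + θ(a)θ(u))`.
* §2 `measurableSet_chartClass`, `ae_snd_ne_zero`, `indicator_chartClass_eq`, **`setIntegral_chartClass_eq`** — for integrable `G` on `GL₂(𝒪) × F`:
  `∫ p in Sₐ, G p = ½ ∫ G + ½ θ(a) ∫ θ(t·det k)·G(k,t)`.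
* §3 **`detSubgroup_orbits_fourierRegular_of_reg_of_twisted`** — the `hB`-body of ★ p857331 ∕ ★ p857380 at the class `a` from a regular `F_reg` representing
  `μ̂_reg` and a regular `Fr₋` representing the `θ`-twisted transform, `Fr_a = ½ F_reg + ½ θ(a) Fr₋` (★ p857331 §1 does the riders);
  **`detSubgroup_orbits_fourierRegular_of_twisted`** — the same with `F_reg` discharged by ★ (LBGL-2b) p857214.
* §4 **`gl2Nm_nilpotentFourierRegular_of_twisted`** — CM COROLLARY: the (LBU-2⁺) letter of ★ p857300 (token for token, as in ★ p857380) from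
  `hTw` = «for every open index-two `D ≤ (L⁺_v)ˣ` with squares and all Haar data: some adapted `θ` and a regular `Fr₋` with
  `∫ θ(t·det k)·𝓕_{ψ∘ι}f(k·tE₁₂·k⁻¹) d(κ⊗dx) = ∫ f·Fr₋`».  Hence (L-B_U)′ :373 at `N = 2` (every `H`) ⟸ `hTw`.

HONEST LABEL: HC_CM is proved only modulo the 7 printed citations (2 remaining named inputs: hLiu418 = stmt-HodgeConjecture-24832, h413 = stmt-HodgeConjecture-24833)
until rung 0 closes; count-neutral plumbing; `hTw` is NOT ★.

References: [HarishChandra1999AdmissibleDistributions] Harish-Chandra (DeBacker–Sally) (1999), §3 p. 8, Thm. 4.4 p. 11, Lemma 5.2, Lemma 7.8;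
[LabesseLanglands1979] Labesse–Langlands, Canad. J. Math. 31 (1979), §5 (the unstable combination of the two regular unipotent classes of `SL₂`);
[BernsteinZelevinsky1976] Bernstein–Zelevinsky (1976), §1.18.
-/

set_option autoImplicit false
set_option linter.dupNamespace false   -- `Summit.HodgeConjecture.HodgeConjecture.…` (D-0017 nested layout; lakefile exemption for Summits)

noncomputable section

open MeasureTheory Measure Filter Topology TopologicalSpace NumberField IsDedekindDomain
open scoped MatrixGroups NNReal ENNReal
open Literature.NumberTheory.Rogawski1990 Literature.NumberTheory.Automorphic Literature.NumberTheory.Automorphic.UnitaryGroup Literature.NumberTheory.Automorphic.LocalFieldHaar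
open Literature.NumberTheory.GaloisRepresentations Literature.NumberTheory.GaloisRepresentations.IsNonarchimedeanLocalField
open Summit.HodgeConjecture.HodgeConjecture.Cruxes.H413.K2E3LieUnitary
open Summit.HodgeConjecture.HodgeConjecture.Cruxes.H413.K2E3GLnNilpotentFourierPointSupport (isLocSmooth_matrixFourier)
open Summit.HodgeConjecture.HodgeConjecture.Cruxes.H413.K2E3GL2RegularNilpotentOrbitalMeasure (integrable_comp_conjNilp)
open Summit.HodgeConjecture.HodgeConjecture.Cruxes.H413.K2E3GL2RegularNilpotentOrbitPushforward (measurable_conjNilp)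
open Summit.HodgeConjecture.HodgeConjecture.Cruxes.H413.K2E3GL2NilpotentSubgroupOrbitSpace (measurableSet_orbit_subgroup)
open Summit.HodgeConjecture.HodgeConjecture.Cruxes.H413.K2E3GL2NilpotentOrbitsDetClass (isOpen_detSubgroup isNilpotent_nilp_and_ne_zero)
open Summit.HodgeConjecture.HodgeConjecture.Cruxes.H413.K2E3GL2NilpotentOrbitsDetClassChart (conjNilp_mem_orbit_detSubgroup_iff)
open Summit.HodgeConjecture.HodgeConjecture.Cruxes.H413.K2E3GL2NmNilpotentFourierRegularOfOrbits (fourierRegular_of_eq_delta_add_sum)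
open Summit.HodgeConjecture.HodgeConjecture.Cruxes.H413.K2E3U2NilpotentFourierRegularOfGL2NmOrbits (gl2Nm_nilpotentFourierRegular_of_orbits)

namespace Summit.HodgeConjecture.HodgeConjecture.Cruxes.H413.K2E3GL2NmNilpotentFourierRegularOfTwisted

/-! ## §1  Index-two bookkeeping -/

section IndexTwo

variable {F : Type*} [Field F] (D : Subgroup Fˣ)

/-- In a subgroup of index two, `a⁻¹u ∈ D ⟺ (a ∈ D ⟺ u ∈ D)`. [cite: BernsteinZelevinsky1976, §1.18] -/
theorem inv_mul_mem_iff_of_index_two (hidx : D.index = 2) (a u : Fˣ) : a⁻¹ * u ∈ D ↔ (a ∈ D ↔ u ∈ D) := by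
  rw [Subgroup.mul_mem_iff_of_index_two hidx, inv_mem_iff]

/-- An adapted sign `θ` (`= 1` on `D`, `= −1` off `D`) squares to `1` on units. [folklore] -/
theorem theta_mul_self (θ : F → ℂ) (hθ1 : ∀ u : Fˣ, u ∈ D → θ u = 1) (hθ2 : ∀ u : Fˣ, u ∉ D → θ u = -1) (a : Fˣ) :
    θ a * θ a = 1 := by
  by_cases ha : a ∈ D
  · rw [hθ1 a ha, mul_one]
  · rw [hθ2 a ha]; norm_num

open scoped Classical in
/-- **`1[a⁻¹u ∈ D]·z = ½ (z + θ(a)·(θ(u)·z))`** for an index-two `D` and an adapted sign `θ`. [cite: LabesseLanglands1979, §5] -/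
theorem indicator_coeff_eq (hidx : D.index = 2) (θ : F → ℂ) (hθ1 : ∀ u : Fˣ, u ∈ D → θ u = 1) (hθ2 : ∀ u : Fˣ, u ∉ D → θ u = -1)
    (a u : Fˣ) (z : ℂ) :
    (if a⁻¹ * u ∈ D then z else 0) = 2⁻¹ * (z + θ a * (θ u * z)) := by
  rw [inv_mul_mem_iff_of_index_two D hidx]
  by_cases ha : a ∈ D <;> by_cases hu : u ∈ D
  · rw [if_pos (iff_of_true ha hu), hθ1 a ha, hθ1 u hu]; ring
  · rw [if_neg (fun h => hu (h.1 ha)), hθ1 a ha, hθ2 u hu]; ring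
  · rw [if_neg (fun h => ha (h.2 hu)), hθ2 a ha, hθ1 u hu]; ring
  · rw [if_pos (iff_of_false ha hu), hθ2 a ha, hθ2 u hu]; ring

end IndexTwo

/-! ## §2  The class sets in the chart and the split of the class orbital integral -/

section Split

variable {F : Type*} [Field F] [ValuativeRel F] [TopologicalSpace F] [IsNonarchimedeanLocalField F] (D : Subgroup Fˣ)
  [MeasurableSpace F] [BorelSpace F] [MeasurableSpace (GL (Fin 2) F)] [BorelSpace (GL (Fin 2) F)]
  [MeasurableSpace (Matrix (Fin 2) (Fin 2) F)] [BorelSpace (Matrix (Fin 2) (Fin 2) F)]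
  (κ : Measure ↥(glInt 2 F)) (dx : Measure F)

/-- The class set `Sₐ = chart⁻¹(𝒪ₐ)`, `𝒪ₐ = Ad(det⁻¹D)·aE₁₂`, is measurable in `GL₂(𝒪) × F` (`D` open). [cite: HarishChandra1999AdmissibleDistributions, Lemma 5.2] -/
theorem measurableSet_chartClass (hDo : IsOpen (D : Set Fˣ)) (a : Fˣ) :
    MeasurableSet {p : ↥(glInt 2 F) × F | ((p.1 : GL (Fin 2) F) : Matrix (Fin 2) (Fin 2) F) * !![0, p.2; 0, 0] *
        ((((p.1 : GL (Fin 2) F))⁻¹ : GL (Fin 2) F) : Matrix (Fin 2) (Fin 2) F) ∈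
          MulAction.orbit ↥((D.comap (Matrix.GeneralLinearGroup.det : GL (Fin 2) F →* Fˣ)).comap
            (ConjAct.ofConjAct : ConjAct (GL (Fin 2) F) ≃* GL (Fin 2) F).toMonoidHom) (!![0, (a : F); 0, 0] : Matrix (Fin 2) (Fin 2) F)} :=
  (measurableSet_orbit_subgroup _ (isOpen_detSubgroup D hDo) (isNilpotent_nilp_and_ne_zero a).1 (isNilpotent_nilp_and_ne_zero a).2).preimage
    (measurable_conjNilp (F := F))

omit [BorelSpace (GL (Fin 2) F)] [MeasurableSpace (Matrix (Fin 2) (Fin 2) F)] [BorelSpace (Matrix (Fin 2) (Fin 2) F)] in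
/-- `{t = 0}` is `κ ⊗ dx`-null for an additive Haar `dx` on `F`. [folklore] -/
theorem ae_snd_ne_zero [SFinite κ] [dx.IsAddHaarMeasure] : ∀ᵐ p : ↥(glInt 2 F) × F ∂(κ.prod dx), p.2 ≠ 0 := by
  haveI : T2Space F := (isLocalField F).toT2Space
  haveI : LocallyCompactSpace F := (isLocalField F).toLocallyCompactSpace
  haveI : SecondCountableTopology F := secondCountableTopology_localField F
  have h0 : (κ.prod dx) (Set.univ ×ˢ ({0} : Set F)) = 0 := by
    rw [Measure.prod_prod, measure_singleton_zero dx, mul_zero]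
  rw [ae_iff]
  refine measure_mono_null (fun p hp => ?_) h0
  simp only [ne_eq, Set.mem_setOf_eq, not_not] at hp
  exact Set.mk_mem_prod (Set.mem_univ _) hp

omit [TopologicalSpace F] [IsNonarchimedeanLocalField F] [MeasurableSpace F] [BorelSpace F] [MeasurableSpace (GL (Fin 2) F)] [BorelSpace (GL (Fin 2) F)]
  [MeasurableSpace (Matrix (Fin 2) (Fin 2) F)] [BorelSpace (Matrix (Fin 2) (Fin 2) F)] in
/-- **Pointwise split off `t = 0`**: `1_{Sₐ}(k,t)·G(k,t) = ½ (G + θ(a)·θ(t·det k)·G)(k,t)` for `t ≠ 0` (★ p857391 `conjNilp_mem_orbit_detSubgroup_iff` + §1).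
[cite: HarishChandra1999AdmissibleDistributions, Lemma 5.2] [cite: LabesseLanglands1979, §5] -/
theorem indicator_chartClass_eq (hD2 : ∀ u : Fˣ, u * u ∈ D) (hidx : D.index = 2) (θ : F → ℂ) (hθ1 : ∀ u : Fˣ, u ∈ D → θ u = 1)
    (hθ2 : ∀ u : Fˣ, u ∉ D → θ u = -1) (a : Fˣ) (G : ↥(glInt 2 F) × F → ℂ) (p : ↥(glInt 2 F) × F) (hp : p.2 ≠ 0) :
    {p : ↥(glInt 2 F) × F | ((p.1 : GL (Fin 2) F) : Matrix (Fin 2) (Fin 2) F) * !![0, p.2; 0, 0] *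
        ((((p.1 : GL (Fin 2) F))⁻¹ : GL (Fin 2) F) : Matrix (Fin 2) (Fin 2) F) ∈
          MulAction.orbit ↥((D.comap (Matrix.GeneralLinearGroup.det : GL (Fin 2) F →* Fˣ)).comap
            (ConjAct.ofConjAct : ConjAct (GL (Fin 2) F) ≃* GL (Fin 2) F).toMonoidHom) (!![0, (a : F); 0, 0] : Matrix (Fin 2) (Fin 2) F)}.indicator G p =
      2⁻¹ * (G p + θ a * (θ (p.2 * (((p.1 : GL (Fin 2) F) : Matrix (Fin 2) (Fin 2) F)).det) * G p)) := by
  classical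
  have hmem := conjNilp_mem_orbit_detSubgroup_iff D hD2 (p.1 : GL (Fin 2) F) p.2 a
  have hu : (((Units.mk0 p.2 hp * Matrix.GeneralLinearGroup.det (p.1 : GL (Fin 2) F) : Fˣ)) : F) =
      p.2 * (((p.1 : GL (Fin 2) F) : Matrix (Fin 2) (Fin 2) F)).det := by
    rw [Units.val_mul, Units.val_mk0, Matrix.GeneralLinearGroup.val_det_apply]
  rw [← hu, ← indicator_coeff_eq D hidx θ hθ1 hθ2 a (Units.mk0 p.2 hp * Matrix.GeneralLinearGroup.det (p.1 : GL (Fin 2) F)) (G p)]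
  simp only [Set.indicator_apply, Set.mem_setOf_eq]
  by_cases h : a⁻¹ * (Units.mk0 p.2 hp * Matrix.GeneralLinearGroup.det (p.1 : GL (Fin 2) F)) ∈ D
  · rw [if_pos h, if_pos (hmem.2 ⟨hp, h⟩)]
  · rw [if_neg h, if_neg (fun h' => h (by obtain ⟨_, h''⟩ := hmem.1 h'; exact h''))]

/-- **SPLIT OF THE CLASS ORBITAL INTEGRAL**: for `G` integrable on `GL₂(𝒪) × F`,
`∫ p in Sₐ, G p d(κ⊗dx) = ½ ∫ G + ½ θ(a) ∫ θ(t·det k)·G(k,t)` (index-two `D ∋` squares, adapted `θ`; `{t = 0}` is null).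
[cite: HarishChandra1999AdmissibleDistributions, Lemma 5.2] [cite: LabesseLanglands1979, §5] -/
theorem setIntegral_chartClass_eq [SFinite κ] [dx.IsAddHaarMeasure] (hDo : IsOpen (D : Set Fˣ)) (hD2 : ∀ u : Fˣ, u * u ∈ D) (hidx : D.index = 2)
    (θ : F → ℂ) (hθ1 : ∀ u : Fˣ, u ∈ D → θ u = 1) (hθ2 : ∀ u : Fˣ, u ∉ D → θ u = -1) (a : Fˣ)
    {G : ↥(glInt 2 F) × F → ℂ} (hG : Integrable G (κ.prod dx)) :
    ∫ p in {p : ↥(glInt 2 F) × F | ((p.1 : GL (Fin 2) F) : Matrix (Fin 2) (Fin 2) F) * !![0, p.2; 0, 0] *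
        ((((p.1 : GL (Fin 2) F))⁻¹ : GL (Fin 2) F) : Matrix (Fin 2) (Fin 2) F) ∈
          MulAction.orbit ↥((D.comap (Matrix.GeneralLinearGroup.det : GL (Fin 2) F →* Fˣ)).comap
            (ConjAct.ofConjAct : ConjAct (GL (Fin 2) F) ≃* GL (Fin 2) F).toMonoidHom) (!![0, (a : F); 0, 0] : Matrix (Fin 2) (Fin 2) F)}, G p ∂(κ.prod dx) =
      2⁻¹ * ∫ p, G p ∂(κ.prod dx) +
        2⁻¹ * θ a * ∫ p, θ (p.2 * (((p.1 : GL (Fin 2) F) : Matrix (Fin 2) (Fin 2) F)).det) * G p ∂(κ.prod dx) := by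
  classical
  have hS := measurableSet_chartClass D hDo a
  have hae := ae_snd_ne_zero κ dx (F := F)
  have hθa := theta_mul_self D θ hθ1 hθ2 a
  -- the pointwise identity, a.e.
  have hpt : ∀ᵐ p : ↥(glInt 2 F) × F ∂(κ.prod dx),
      {p : ↥(glInt 2 F) × F | ((p.1 : GL (Fin 2) F) : Matrix (Fin 2) (Fin 2) F) * !![0, p.2; 0, 0] *
        ((((p.1 : GL (Fin 2) F))⁻¹ : GL (Fin 2) F) : Matrix (Fin 2) (Fin 2) F) ∈
          MulAction.orbit ↥((D.comap (Matrix.GeneralLinearGroup.det : GL (Fin 2) F →* Fˣ)).comap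
            (ConjAct.ofConjAct : ConjAct (GL (Fin 2) F) ≃* GL (Fin 2) F).toMonoidHom) (!![0, (a : F); 0, 0] : Matrix (Fin 2) (Fin 2) F)}.indicator G p =
      2⁻¹ * (G p + θ a * (θ (p.2 * (((p.1 : GL (Fin 2) F) : Matrix (Fin 2) (Fin 2) F)).det) * G p)) :=
    hae.mono fun p hp => indicator_chartClass_eq D hD2 hidx θ hθ1 hθ2 a G p hp
  -- integrability of the twisted integrand: `θ(t det k)·G = θ(a)·(2·1_{Sₐ}G − G)` a.e.
  have hθG : Integrable (fun p : ↥(glInt 2 F) × F => θ (p.2 * (((p.1 : GL (Fin 2) F) : Matrix (Fin 2) (Fin 2) F)).det) * G p) (κ.prod dx) := by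
    have hI : Integrable (fun p : ↥(glInt 2 F) × F => θ a * (2 * {p : ↥(glInt 2 F) × F | ((p.1 : GL (Fin 2) F) : Matrix (Fin 2) (Fin 2) F) * !![0, p.2; 0, 0] *
        ((((p.1 : GL (Fin 2) F))⁻¹ : GL (Fin 2) F) : Matrix (Fin 2) (Fin 2) F) ∈
          MulAction.orbit ↥((D.comap (Matrix.GeneralLinearGroup.det : GL (Fin 2) F →* Fˣ)).comap
            (ConjAct.ofConjAct : ConjAct (GL (Fin 2) F) ≃* GL (Fin 2) F).toMonoidHom) (!![0, (a : F); 0, 0] : Matrix (Fin 2) (Fin 2) F)}.indicator G p - G p))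
        (κ.prod dx) :=
      (((hG.indicator hS).const_mul 2).sub hG).const_mul (θ a)
    refine hI.congr (hpt.mono fun p hp => ?_)
    simp only at hp ⊢
    rw [hp]
    linear_combination (θ (p.2 * (((p.1 : GL (Fin 2) F) : Matrix (Fin 2) (Fin 2) F)).det) * G p) * hθa
  rw [← integral_indicator hS, integral_congr_ae hpt, integral_const_mul, integral_add hG (hθG.const_mul (θ a)), integral_const_mul]
  ring

end Split

/-! ## §3  The `hB`-body from `F_reg` and the `θ`-twisted function -/

section Head

variable {F : Type*} [Field F] [ValuativeRel F] [TopologicalSpace F] [IsNonarchimedeanLocalField F] (D : Subgroup Fˣ)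
  (ψ : AddChar F Circle) [MeasurableSpace (Matrix (Fin 2) (Fin 2) F)] [BorelSpace (Matrix (Fin 2) (Fin 2) F)] (μ𝔤 : Measure (Matrix (Fin 2) (Fin 2) F)) [μ𝔤.IsAddHaarMeasure]
  [MeasurableSpace F] [BorelSpace F] [MeasurableSpace (GL (Fin 2) F)] [BorelSpace (GL (Fin 2) F)]
  (κ : Measure ↥(glInt 2 F)) [IsFiniteMeasureOnCompacts κ] [SFinite κ] (dx : Measure F) [dx.IsAddHaarMeasure]

/-- **THE `hB` DOCK (abstract form)**: index-two `D ∋` squares, adapted sign `θ`; IF `μ̂_reg` (the full `(k,t)`-chart orbital integral composed with `𝓕_ψ`) is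
represented by a regular `F_reg` AND the `θ(t·det k)`-twisted one by a regular `Fr₋` (regular = locally integrable, locally constant on `{disc ∈ Fˣ}`,
`|disc|^{1∕2}·‖·‖` locally bounded), THEN the class orbital integral over `Sₐ = chart⁻¹(𝒪ₐ)` composed with `𝓕_ψ` is represented by the regular
`½ F_reg + ½ θ(a) Fr₋` — the `hB`-body of ★ p857331 ∕ ★ p857380 at the class `a`. [cite: HarishChandra1999AdmissibleDistributions, Thm. 4.4 p. 11, Lemma 5.2, Lemma 7.8]
[cite: LabesseLanglands1979, §5] -/
theorem detSubgroup_orbits_fourierRegular_of_reg_of_twisted (hψ : ψ.IsContinuousNontrivial) (hDo : IsOpen (D : Set Fˣ)) (hD2 : ∀ u : Fˣ, u * u ∈ D)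
    (hidx : D.index = 2) (θ : F → ℂ) (hθ1 : ∀ u : Fˣ, u ∈ D → θ u = 1) (hθ2 : ∀ u : Fˣ, u ∉ D → θ u = -1)
    {Freg : Matrix (Fin 2) (Fin 2) F → ℂ} (hReg_int : LocallyIntegrable Freg μ𝔤)
    (hReg_rep : ∀ f : Matrix (Fin 2) (Fin 2) F → ℂ, IsLocSmooth f →
      ∫ p : ↥(glInt 2 F) × F, (fun Y : Matrix (Fin 2) (Fin 2) F => ∫ X, ((ψ (Matrix.trace (Y * X)) : Circle) : ℂ) * f X ∂μ𝔤)
          (((p.1 : GL (Fin 2) F) : Matrix (Fin 2) (Fin 2) F) * !![0, p.2; 0, 0] * ((((p.1 : GL (Fin 2) F))⁻¹ : GL (Fin 2) F) : Matrix (Fin 2) (Fin 2) F)) ∂(κ.prod dx) =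
        ∫ X, f X * Freg X ∂μ𝔤)
    (hReg_lc : ∀ X : Matrix (Fin 2) (Fin 2) F, IsUnit X.charpoly.discr → ∀ᶠ Y in 𝓝 X, Freg Y = Freg X)
    (hReg_bd : ∀ C : Set (Matrix (Fin 2) (Fin 2) F), IsCompact C → ∃ B : ℝ, ∀ X ∈ C, ((NNReal.sqrt (normAbs F X.charpoly.discr) : ℝ≥0) : ℝ) * ‖Freg X‖ ≤ B)
    {Frm : Matrix (Fin 2) (Fin 2) F → ℂ} (hTw_int : LocallyIntegrable Frm μ𝔤)
    (hTw_rep : ∀ f : Matrix (Fin 2) (Fin 2) F → ℂ, IsLocSmooth f →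
      ∫ p : ↥(glInt 2 F) × F, θ (p.2 * (((p.1 : GL (Fin 2) F) : Matrix (Fin 2) (Fin 2) F)).det) *
          (fun Y : Matrix (Fin 2) (Fin 2) F => ∫ X, ((ψ (Matrix.trace (Y * X)) : Circle) : ℂ) * f X ∂μ𝔤)
            (((p.1 : GL (Fin 2) F) : Matrix (Fin 2) (Fin 2) F) * !![0, p.2; 0, 0] * ((((p.1 : GL (Fin 2) F))⁻¹ : GL (Fin 2) F) : Matrix (Fin 2) (Fin 2) F)) ∂(κ.prod dx) =
        ∫ X, f X * Frm X ∂μ𝔤)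
    (hTw_lc : ∀ X : Matrix (Fin 2) (Fin 2) F, IsUnit X.charpoly.discr → ∀ᶠ Y in 𝓝 X, Frm Y = Frm X)
    (hTw_bd : ∀ C : Set (Matrix (Fin 2) (Fin 2) F), IsCompact C → ∃ B : ℝ, ∀ X ∈ C, ((NNReal.sqrt (normAbs F X.charpoly.discr) : ℝ≥0) : ℝ) * ‖Frm X‖ ≤ B)
    (a : Fˣ) :
    ∃ Fr : (Matrix (Fin 2) (Fin 2) F) → ℂ, LocallyIntegrable Fr μ𝔤 ∧
      (∀ f : (Matrix (Fin 2) (Fin 2) F) → ℂ, IsLocSmooth f →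
        ∫ p in {p : ↥(glInt 2 F) × F | (((p.1 : GL (Fin 2) F) : Matrix (Fin 2) (Fin 2) F) * !![0, p.2; 0, 0] * ((((p.1 : GL (Fin 2) F))⁻¹ : GL (Fin 2) F) : Matrix (Fin 2) (Fin 2) F)) ∈ MulAction.orbit ↥((D.comap (Matrix.GeneralLinearGroup.det : GL (Fin 2) F →* Fˣ)).comap (ConjAct.ofConjAct : ConjAct (GL (Fin 2) F) ≃* GL (Fin 2) F).toMonoidHom) (!![0, (a : F); 0, 0] : Matrix (Fin 2) (Fin 2) F)}, (fun Y : Matrix (Fin 2) (Fin 2) F => ∫ X, ((ψ (Matrix.trace (Y * X)) : Circle) : ℂ) * f X ∂μ𝔤) (((p.1 : GL (Fin 2) F) : Matrix (Fin 2) (Fin 2) F) * !![0, p.2; 0, 0] * ((((p.1 : GL (Fin 2) F))⁻¹ : GL (Fin 2) F) : Matrix (Fin 2) (Fin 2) F)) ∂(κ.prod dx) = ∫ X, f X * Fr X ∂μ𝔤) ∧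
      (∀ X : Matrix (Fin 2) (Fin 2) F, IsUnit X.charpoly.discr → ∀ᶠ Y in 𝓝 X, Fr Y = Fr X) ∧
      (∀ C : Set (Matrix (Fin 2) (Fin 2) F), IsCompact C → ∃ B : ℝ, ∀ X ∈ C, ((NNReal.sqrt (normAbs F X.charpoly.discr) : ℝ≥0) : ℝ) * ‖Fr X‖ ≤ B) := by
  classical
  -- ★ p857331 §1 with `T = ν_{Sₐ}`, `a₀ = 0`, `c = (½, ½θ(a))`, `ν = (μ_reg, ν_θ)`, `Fr = (F_reg, Fr₋)`
  have key := fourierRegular_of_eq_delta_add_sum ψ μ𝔤 hψ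
    (fun f' : (Matrix (Fin 2) (Fin 2) F) → ℂ => ∫ p in {p : ↥(glInt 2 F) × F | (((p.1 : GL (Fin 2) F) : Matrix (Fin 2) (Fin 2) F) * !![0, p.2; 0, 0] * ((((p.1 : GL (Fin 2) F))⁻¹ : GL (Fin 2) F) : Matrix (Fin 2) (Fin 2) F)) ∈ MulAction.orbit ↥((D.comap (Matrix.GeneralLinearGroup.det : GL (Fin 2) F →* Fˣ)).comap (ConjAct.ofConjAct : ConjAct (GL (Fin 2) F) ≃* GL (Fin 2) F).toMonoidHom) (!![0, (a : F); 0, 0] : Matrix (Fin 2) (Fin 2) F)},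
      f' (((p.1 : GL (Fin 2) F) : Matrix (Fin 2) (Fin 2) F) * !![0, p.2; 0, 0] * ((((p.1 : GL (Fin 2) F))⁻¹ : GL (Fin 2) F) : Matrix (Fin 2) (Fin 2) F)) ∂(κ.prod dx))
    0 ![2⁻¹, 2⁻¹ * θ a]
    ![fun f' : (Matrix (Fin 2) (Fin 2) F) → ℂ => ∫ p : ↥(glInt 2 F) × F,
        f' (((p.1 : GL (Fin 2) F) : Matrix (Fin 2) (Fin 2) F) * !![0, p.2; 0, 0] * ((((p.1 : GL (Fin 2) F))⁻¹ : GL (Fin 2) F) : Matrix (Fin 2) (Fin 2) F)) ∂(κ.prod dx),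
      fun f' : (Matrix (Fin 2) (Fin 2) F) → ℂ => ∫ p : ↥(glInt 2 F) × F, θ (p.2 * (((p.1 : GL (Fin 2) F) : Matrix (Fin 2) (Fin 2) F)).det) *
        f' (((p.1 : GL (Fin 2) F) : Matrix (Fin 2) (Fin 2) F) * !![0, p.2; 0, 0] * ((((p.1 : GL (Fin 2) F))⁻¹ : GL (Fin 2) F) : Matrix (Fin 2) (Fin 2) F)) ∂(κ.prod dx)]
    (fun f' hf' => by
      rw [setIntegral_chartClass_eq D κ dx hDo hD2 hidx θ hθ1 hθ2 a (integrable_comp_conjNilp κ dx hf'), zero_mul, zero_add, Fin.sum_univ_two]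
      simp only [Matrix.cons_val_zero, Matrix.cons_val_one])
    ![Freg, Frm]
    (fun i => by fin_cases i <;> assumption)
    (fun i f' hf' => by
      fin_cases i
      · exact hReg_rep f' hf'
      · exact hTw_rep f' hf')
    (fun i => by fin_cases i <;> assumption)
    (fun i => by fin_cases i <;> assumption)
  obtain ⟨h1, h2, h3, h4⟩ := key
  exact ⟨_, h1, h2, h3, h4⟩

/-- **THE `hB` DOCK** (★ (LBGL-2b) consumed): for `F` of characteristic `0`, index-two `D ∋` squares, adapted `θ`, Haar `κ` on `GL₂(𝒪)` and additive Haar `dx`,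
`μ𝔤`: IF the `θ(t·det k)`-twisted regular nilpotent orbital integral composed with `𝓕_ψ` is represented by a regular `Fr₋` (`hTw`), THEN every class orbital
integral `ν_{𝒪ₐ} ∘ 𝓕_ψ` is represented by a regular function (`½ F_reg + ½ θ(a) Fr₋`, `F_reg` from ★ p857214 `gl2RegularNilpotentFourier`) — the `hB`-body of
★ p857331 `detSubgroup_nilpotentFourierRegular_of_orbits` ∕ ★ p857380 at the class `a`. [cite: HarishChandra1999AdmissibleDistributions, Thm. 4.4 p. 11, Lemma 5.2, Lemma 7.8]
[cite: LabesseLanglands1979, §5] -/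
theorem detSubgroup_orbits_fourierRegular_of_twisted {F : Type} [Field F] [ValuativeRel F] [TopologicalSpace F] [IsNonarchimedeanLocalField F] [CharZero F]
    (D : Subgroup Fˣ) (ψ : AddChar F Circle) [MeasurableSpace (Matrix (Fin 2) (Fin 2) F)] [BorelSpace (Matrix (Fin 2) (Fin 2) F)]
    (μ𝔤 : Measure (Matrix (Fin 2) (Fin 2) F)) [μ𝔤.IsAddHaarMeasure] [MeasurableSpace F] [BorelSpace F] [MeasurableSpace (GL (Fin 2) F)] [BorelSpace (GL (Fin 2) F)]
    (κ : Measure ↥(glInt 2 F)) [IsHaarMeasure κ] (dx : Measure F) [dx.IsAddHaarMeasure]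
    (hψ : ψ.IsContinuousNontrivial) (hDo : IsOpen (D : Set Fˣ)) (hD2 : ∀ u : Fˣ, u * u ∈ D) (hidx : D.index = 2)
    (θ : F → ℂ) (hθ1 : ∀ u : Fˣ, u ∈ D → θ u = 1) (hθ2 : ∀ u : Fˣ, u ∉ D → θ u = -1)
    {Frm : Matrix (Fin 2) (Fin 2) F → ℂ} (hTw_int : LocallyIntegrable Frm μ𝔤)
    (hTw_rep : ∀ f : Matrix (Fin 2) (Fin 2) F → ℂ, IsLocSmooth f →
      ∫ p : ↥(glInt 2 F) × F, θ (p.2 * (((p.1 : GL (Fin 2) F) : Matrix (Fin 2) (Fin 2) F)).det) *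
          (fun Y : Matrix (Fin 2) (Fin 2) F => ∫ X, ((ψ (Matrix.trace (Y * X)) : Circle) : ℂ) * f X ∂μ𝔤)
            (((p.1 : GL (Fin 2) F) : Matrix (Fin 2) (Fin 2) F) * !![0, p.2; 0, 0] * ((((p.1 : GL (Fin 2) F))⁻¹ : GL (Fin 2) F) : Matrix (Fin 2) (Fin 2) F)) ∂(κ.prod dx) =
        ∫ X, f X * Frm X ∂μ𝔤)
    (hTw_lc : ∀ X : Matrix (Fin 2) (Fin 2) F, IsUnit X.charpoly.discr → ∀ᶠ Y in 𝓝 X, Frm Y = Frm X)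
    (hTw_bd : ∀ C : Set (Matrix (Fin 2) (Fin 2) F), IsCompact C → ∃ B : ℝ, ∀ X ∈ C, ((NNReal.sqrt (normAbs F X.charpoly.discr) : ℝ≥0) : ℝ) * ‖Frm X‖ ≤ B)
    (a : Fˣ) :
    ∃ Fr : (Matrix (Fin 2) (Fin 2) F) → ℂ, LocallyIntegrable Fr μ𝔤 ∧
      (∀ f : (Matrix (Fin 2) (Fin 2) F) → ℂ, IsLocSmooth f →
        ∫ p in {p : ↥(glInt 2 F) × F | (((p.1 : GL (Fin 2) F) : Matrix (Fin 2) (Fin 2) F) * !![0, p.2; 0, 0] * ((((p.1 : GL (Fin 2) F))⁻¹ : GL (Fin 2) F) : Matrix (Fin 2) (Fin 2) F)) ∈ MulAction.orbit ↥((D.comap (Matrix.GeneralLinearGroup.det : GL (Fin 2) F →* Fˣ)).comap (ConjAct.ofConjAct : ConjAct (GL (Fin 2) F) ≃* GL (Fin 2) F).toMonoidHom) (!![0, (a : F); 0, 0] : Matrix (Fin 2) (Fin 2) F)}, (fun Y : Matrix (Fin 2) (Fin 2) F => ∫ X, ((ψ (Matrix.trace (Y * X)) : Circle) : ℂ) *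 f X ∂μ𝔤) (((p.1 : GL (Fin 2) F) : Matrix (Fin 2) (Fin 2) F) * !![0, p.2; 0, 0] * ((((p.1 : GL (Fin 2) F))⁻¹ : GL (Fin 2) F) : Matrix (Fin 2) (Fin 2) F)) ∂(κ.prod dx) = ∫ X, f X * Fr X ∂μ𝔤) ∧
      (∀ X : Matrix (Fin 2) (Fin 2) F, IsUnit X.charpoly.discr → ∀ᶠ Y in 𝓝 X, Fr Y = Fr X) ∧
      (∀ C : Set (Matrix (Fin 2) (Fin 2) F), IsCompact C → ∃ B : ℝ, ∀ X ∈ C, ((NNReal.sqrt (normAbs F X.charpoly.discr) : ℝ≥0) : ℝ) * ‖Fr X‖ ≤ B) := by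
  haveI : CompactSpace ↥(glInt 2 F) := isCompact_iff_compactSpace.1 (isCompact_glInt 2 F)
  obtain ⟨Freg, hReg_int, hReg_rep, hReg_lc, hReg_bd⟩ :=
    K2E3GL2RegularNilpotentFourier.gl2RegularNilpotentFourier F ψ hψ μ𝔤 κ dx
  exact detSubgroup_orbits_fourierRegular_of_reg_of_twisted D ψ μ𝔤 κ dx hψ hDo hD2 hidx θ hθ1 hθ2 hReg_int hReg_rep hReg_lc hReg_bd
    hTw_int hTw_rep hTw_lc hTw_bd a

end Head

/-! ## §4  The CM corollary: (LBU-2⁺) from the `θ`-twisted regular nilpotent orbital integral -/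

section CM

variable (L : Type) [Field L] [NumberField L] [IsCMField L] (v : HeightOneSpectrum (𝓞 ↥(maximalRealSubfield L)))
  (w : UnitaryGroup.PlacesOver L v) (hw : IsCMField.complexConj L • w.1 = w.1)

/-- **(LBU-2⁺) «(L-B_GL)^{Nm} ON `𝔤𝔩₂(L⁺_v)`» (the letter `hGL` of ★ p857300, token for token as in ★ p857380) ⟸ `hTw`**: for every open index-two
`D ≤ (L⁺_v)ˣ` containing the squares and all Haar data, SOME sign `θ` adapted to `D` (`+1` on `D`, `−1` off `D`) and a regular `Fr₋` representing the
`θ(t·det k)`-twisted regular nilpotent orbital integral composed with `𝓕_{ψ∘ι}`.  ★ p857380 `gl2Nm_nilpotentFourierRegular_of_orbits` ∘ §3 (`F_reg` from ★ p857214,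
`char (L⁺_v) = 0`).  Hence, with ★ p857300, (L-B_U)′ :373 at `N = 2` for every `H` reduces to `hTw`.
[cite: HarishChandra1999AdmissibleDistributions, Thm. 4.4 p. 11, Lemma 5.2, Lemma 7.8] [cite: LabesseLanglands1979, §5] [cite: Omeara1963, §63B 63:13] -/
theorem gl2Nm_nilpotentFourierRegular_of_twisted (ψ : AddChar (w.1.adicCompletion L) Circle) (hψ : ψ.IsContinuousNontrivial)
    (hψι : ∃ a : w.1.adicCompletion L, galAdicCompletionMap (L := L) (IsCMField.complexConj L) hw a = a ∧ ψ a ≠ 1)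
    (hTw : ∀ (D : Subgroup (v.adicCompletion ↥(maximalRealSubfield L))ˣ), IsOpen (D : Set (v.adicCompletion ↥(maximalRealSubfield L))ˣ) → (∀ u : (v.adicCompletion ↥(maximalRealSubfield L))ˣ, u * u ∈ D) → D.index = 2 →
      ∀ [MeasurableSpace (v.adicCompletion ↥(maximalRealSubfield L))] [BorelSpace (v.adicCompletion ↥(maximalRealSubfield L))] [MeasurableSpace (GL (Fin 2) (v.adicCompletion ↥(maximalRealSubfield L)))] [BorelSpace (GL (Fin 2) (v.adicCompletion ↥(maximalRealSubfield L)))]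
        (κ : Measure ↥(glInt 2 (v.adicCompletion ↥(maximalRealSubfield L)))) [IsHaarMeasure κ] (dx : Measure (v.adicCompletion ↥(maximalRealSubfield L))) [dx.IsAddHaarMeasure]
        [MeasurableSpace (Matrix (Fin 2) (Fin 2) (v.adicCompletion ↥(maximalRealSubfield L)))] [BorelSpace (Matrix (Fin 2) (Fin 2) (v.adicCompletion ↥(maximalRealSubfield L)))] (μ' : Measure (Matrix (Fin 2) (Fin 2) (v.adicCompletion ↥(maximalRealSubfield L)))) [μ'.IsAddHaarMeasure],
      ∃ θ : v.adicCompletion ↥(maximalRealSubfield L) → ℂ, (∀ u : (v.adicCompletion ↥(maximalRealSubfield L))ˣ, u ∈ D → θ u = 1) ∧ (∀ u : (v.adicCompletion ↥(maximalRealSubfield L))ˣ, u ∉ D → θ u = -1) ∧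
      ∃ Fr : (Matrix (Fin 2) (Fin 2) (v.adicCompletion ↥(maximalRealSubfield L))) → ℂ, LocallyIntegrable Fr μ' ∧
        (∀ f : (Matrix (Fin 2) (Fin 2) (v.adicCompletion ↥(maximalRealSubfield L))) → ℂ, IsLocSmooth f →
          ∫ p : ↥(glInt 2 (v.adicCompletion ↥(maximalRealSubfield L))) × (v.adicCompletion ↥(maximalRealSubfield L)), θ (p.2 * (((p.1 : GL (Fin 2) (v.adicCompletion ↥(maximalRealSubfield L))) : Matrix (Fin 2) (Fin 2) (v.adicCompletion ↥(maximalRealSubfield L)))).det) * (fun Y : Matrix (Fin 2) (Fin 2) (v.adicCompletion ↥(maximalRealSubfield L)) => ∫ X, ((ψ (toPlace v w (Matrix.trace (Y * X))) : Circle) : ℂ) * f X ∂μ') ((((p.1 : GL (Fin 2) (v.adicCompletion ↥(maximalRealSubfield L))) : Matrix (Fin 2) (Fin 2) (v.adicCompletion ↥(maximalRealSubfield L))) * !![0, p.2; 0, 0] * ((((p.1 : GL (Fin 2) (v.adicCompletion ↥(maximalRealSubfield L))))⁻¹ : GL (Fin 2) (v.adicCompletion ↥(maximalRealSubfield L)))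 : Matrix (Fin 2) (Fin 2) (v.adicCompletion ↥(maximalRealSubfield L))))) ∂(κ.prod dx) = ∫ X, f X * Fr X ∂μ') ∧
        (∀ X : Matrix (Fin 2) (Fin 2) (v.adicCompletion ↥(maximalRealSubfield L)), IsUnit X.charpoly.discr → ∀ᶠ Y in 𝓝 X, Fr Y = Fr X) ∧
        (∀ C : Set (Matrix (Fin 2) (Fin 2) (v.adicCompletion ↥(maximalRealSubfield L))), IsCompact C → ∃ B : ℝ, ∀ X ∈ C, ((NNReal.sqrt (normAbs (v.adicCompletion ↥(maximalRealSubfield L)) X.charpoly.discr) : ℝ≥0) : ℝ) * ‖Fr X‖ ≤ B)) :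
    ∀ [MeasurableSpace (Matrix (Fin 2) (Fin 2) (v.adicCompletion ↥(maximalRealSubfield L)))] [BorelSpace (Matrix (Fin 2) (Fin 2) (v.adicCompletion ↥(maximalRealSubfield L)))] (μ' : Measure (Matrix (Fin 2) (Fin 2) (v.adicCompletion ↥(maximalRealSubfield L)))) [μ'.IsAddHaarMeasure]
      (T' : ((Matrix (Fin 2) (Fin 2) (v.adicCompletion ↥(maximalRealSubfield L))) → ℂ) → ℂ),
      (∀ f₁ f₂ : (Matrix (Fin 2) (Fin 2) (v.adicCompletion ↥(maximalRealSubfield L))) → ℂ, IsLocSmooth f₁ → IsLocSmooth f₂ → T' (f₁ + f₂) = T' f₁ + T' f₂) →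
      (∀ (a : ℂ) (f : (Matrix (Fin 2) (Fin 2) (v.adicCompletion ↥(maximalRealSubfield L))) → ℂ), IsLocSmooth f → T' (a • f) = a * T' f) →
      (∀ g : GL (Fin 2) (v.adicCompletion ↥(maximalRealSubfield L)), (∃ e : w.1.adicCompletion L, toPlace v w ((g : Matrix (Fin 2) (Fin 2) (v.adicCompletion ↥(maximalRealSubfield L))).det) * (e * galAdicCompletionMap (L := L) (IsCMField.complexConj L) hw e) = 1) →
        ∀ f : (Matrix (Fin 2) (Fin 2) (v.adicCompletion ↥(maximalRealSubfield L))) → ℂ, IsLocSmooth f → T' (fun X => f ((g : Matrix (Fin 2) (Fin 2) (v.adicCompletion ↥(maximalRealSubfield L))) * X * ((g⁻¹ : GL (Fin 2) (v.adicCompletion ↥(maximalRealSubfield L))) : Matrix (Fin 2) (Fin 2) (v.adicCompletion ↥(maximalRealSubfield L))))) = T' f) →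
      (∀ f : (Matrix (Fin 2) (Fin 2) (v.adicCompletion ↥(maximalRealSubfield L))) → ℂ, IsLocSmooth f → (∀ X ∈ tsupport f, ¬ IsNilpotent X) → T' f = 0) →
      ∃ Fn' : (Matrix (Fin 2) (Fin 2) (v.adicCompletion ↥(maximalRealSubfield L))) → ℂ, LocallyIntegrable Fn' μ' ∧
        (∀ f : (Matrix (Fin 2) (Fin 2) (v.adicCompletion ↥(maximalRealSubfield L))) → ℂ, IsLocSmooth f →
          T' (fun Y => ∫ X, ((ψ (toPlace v w (Matrix.trace (Y * X))) : Circle) : ℂ) * f X ∂μ') = ∫ X, f X * Fn' X ∂μ') ∧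
        (∀ X : Matrix (Fin 2) (Fin 2) (v.adicCompletion ↥(maximalRealSubfield L)), IsUnit X.charpoly.discr → ∀ᶠ Y in 𝓝 X, Fn' Y = Fn' X) ∧
        (∀ C : Set (Matrix (Fin 2) (Fin 2) (v.adicCompletion ↥(maximalRealSubfield L))), IsCompact C → ∃ B : ℝ, ∀ X ∈ C, ((NNReal.sqrt (normAbs (v.adicCompletion ↥(maximalRealSubfield L)) X.charpoly.discr) : ℝ≥0) : ℝ) * ‖Fn' X‖ ≤ B) := by
  intro _ _ μ'' _ T' hT1 hT2 hT3 hT4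
  haveI : CharZero (v.adicCompletion ↥(maximalRealSubfield L)) :=
    charZero_of_injective_algebraMap (algebraMap ↥(maximalRealSubfield L) (v.adicCompletion ↥(maximalRealSubfield L))).injective
  refine gl2Nm_nilpotentFourierRegular_of_orbits L v w hw ψ hψ hψι ?_ μ'' T' hT1 hT2 hT3 hT4
  intro D hDo hD2 hidx _ _ _ _ κ _ dx _ _ _ μ' _ a
  obtain ⟨θ, hθ1, hθ2, Frm, hTw_int, hTw_rep, hTw_lc, hTw_bd⟩ := hTw D hDo hD2 hidx κ dx μ'
  -- the character `ψ ∘ ι` read as an additive character of `L⁺_v`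
  have hc1 := IsCMField.complexConj_ne_one L
  have hιr : ∀ y : w.1.adicCompletion L, galAdicCompletionMap (L := L) (IsCMField.complexConj L) hw y = y ↔ y ∈ Set.range (toPlace v w) :=
    fun y => galAdicCompletionMap_eq_self_iff_mem_range (IsCMField.complexConj L) hc1 v w hw y
  let ψF : AddChar (v.adicCompletion ↥(maximalRealSubfield L)) Circle := ψ.compAddMonoidHom (toPlace v w).toAddMonoidHom
  have hψF_apply : ∀ t, ψF t = ψ (toPlace v w t) := fun t => rfl
  have hψF : ψF.IsContinuousNontrivial := by
    refine ⟨hψ.1.comp (continuous_toPlace v w), fun h0 => ?_⟩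
    obtain ⟨a', ha', hψa⟩ := hψι
    obtain ⟨r, rfl⟩ := (hιr a').1 ha'
    have : ψF r = 1 := by rw [h0]; rfl
    exact hψa (by rw [← hψF_apply]; exact this)
  have hTw_rep' : ∀ f : (Matrix (Fin 2) (Fin 2) (v.adicCompletion ↥(maximalRealSubfield L))) → ℂ, IsLocSmooth f →
      ∫ p : ↥(glInt 2 (v.adicCompletion ↥(maximalRealSubfield L))) × (v.adicCompletion ↥(maximalRealSubfield L)), θ (p.2 * (((p.1 : GL (Fin 2) (v.adicCompletion ↥(maximalRealSubfield L))) : Matrix (Fin 2) (Fin 2) (v.adicCompletion ↥(maximalRealSubfield L)))).det) *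
          (fun Y : Matrix (Fin 2) (Fin 2) (v.adicCompletion ↥(maximalRealSubfield L)) => ∫ X, ((ψF (Matrix.trace (Y * X)) : Circle) : ℂ) * f X ∂μ')
            ((((p.1 : GL (Fin 2) (v.adicCompletion ↥(maximalRealSubfield L))) : Matrix (Fin 2) (Fin 2) (v.adicCompletion ↥(maximalRealSubfield L))) * !![0, p.2; 0, 0] * ((((p.1 : GL (Fin 2) (v.adicCompletion ↥(maximalRealSubfield L))))⁻¹ : GL (Fin 2) (v.adicCompletion ↥(maximalRealSubfield L))) : Matrix (Fin 2) (Fin 2) (v.adicCompletion ↥(maximalRealSubfield L))))) ∂(κ.prod dx) =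
        ∫ X, f X * Frm X ∂μ' := fun f hf => by
    simp only [hψF_apply]
    exact hTw_rep f hf
  have key := detSubgroup_orbits_fourierRegular_of_twisted D ψF μ' κ dx hψF hDo hD2 hidx θ hθ1 hθ2 hTw_int hTw_rep' hTw_lc hTw_bd a
  simp only [hψF_apply] at key
  exact key

end CM

end Summit.HodgeConjecture.HodgeConjecture.Cruxes.H413.K2E3GL2NmNilpotentFourierRegularOfTwisted

end
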